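import Summits.Ventures.PercRepro.C041TwoExitMain

/-!
# ROW C-041 — THE TRIANGLE DICTIONARY: the six-vector of the triangle with two hanging zones IS mine-3's triangle
map `thetaTri` (p6, gen 31; C-041.md §21 (b) «the dictionary triCol / the arc-type model = the six-vector of the
triangle», the paper-level step of the cycle theorems)

The TRIANGLE HOST `tri`: the unmarked multigraph on the vertices `0` (the anchor `a`), `1` (`u`), `2` (`u'`) with
the edges `0 : a–u`, `1 : u–u'`, `2 : u'–a`.  On a three-vertex graph a vertex is reached from another iff they are
adjacent or share a common neighbour (`mem_reach_fin3`), so the statuses of a colouring `ω` of the three edges are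
explicit (`Mg01_iff` … `Mg12_iff`): `u` is merged iff `a–u` is blue or both other edges are, reached iff `a–u` is
red or both others are; `u`, `u'` are blue-connected iff `u–u'` is blue or both other edges are.  THE TRIANGLE
ZONE `tri2 Z a Z' a'` (`Z` hung at `u`, `Z'` at `u'`) is the two-exit attachment `glue2 tri 1 2 Z a Z' a'`, and
THEOREM (TWO-EXIT BLOCK MAP) (`C041TwoExitMain`) specialises, colouring by colouring, to mine-3's table `triCol`
(`C041TriangleCone`: the eight colourings `(au, uu', u'a)` with `true` = red):

* **`sixVec_tri2`** — `Π(tri2 Z a Z' a') = thetaTri (Π Z) (Π Z')` at the anchor, for ANY two zones.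

Hence everything proved about `thetaTri` on six-vectors holds for the triangle zone on the graph model —
`K4v_thetaTri_of_rel` (THEOREM (RELAXED TRIANGLE)), `K4v_thetaTri_of_InCone`, the marked-vertex cone certificates —
and the arc-type model of the two-exit cycle (`thetaCyc`) now has its triangle part on the graph model.
-/

namespace PercRepro

namespace ZoneZ

namespace TwoExit

open ZoneData TreeClosure Finset Pendant

/-! ## Reach on three vertices -/

/-- Four vertices of a three-vertex graph: two of them coincide. -/
theorem fin3_pigeon (x z w w' : Fin 3) : w' = x ∨ w' = z ∨ w' = w ∨ z = x ∨ z = w ∨ x = w := by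
  revert x z w w'
  decide

/-- **Reach on three vertices**: `y ≠ x` is reached from `x` iff `x` is adjacent to `y` or the two are joined
through a common neighbour. -/
theorem mem_reach_fin3 (R : Fin 3 → Fin 3 → Prop) {x y : Fin 3} (hxy : x ≠ y) :
    y ∈ reach R {x} ↔ R x y ∨ ∃ z, R x z ∧ R z y := by
  constructor
  · intro h
    have key : reach R {x} ⊆ {w | x = w ∨ R x w ∨ ∃ z, R x z ∧ R z w} := by
      refine reach_subset_of_closed ?_ ?_
      · intro w hw
        rw [Set.mem_singleton_iff] at hw
        exact Or.inl hw.symm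
      · intro w w' hw hww'
        rcases hw with hw | hw | ⟨z, hxz, hzw⟩
        · rw [hw]
          exact Or.inr (Or.inl hww')
        · exact Or.inr (Or.inr ⟨w, hw, hww'⟩)
        · rcases fin3_pigeon x z w w' with h1 | h1 | h1 | h1 | h1 | h1
          · rw [h1]
            exact Or.inl rfl
          · rw [h1]
            exact Or.inr (Or.inl hxz)
          · rw [h1]
            exact Or.inr (Or.inr ⟨z, hxz, hzw⟩)
          · rw [h1] at hzw
            exact Or.inr (Or.inr ⟨w, hzw, hww'⟩)
          · rw [h1] at hxz
            exact Or.inr (Or.inr ⟨w, hxz, hww'⟩)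
          · rw [h1]
            exact Or.inr (Or.inl hww')
    rcases key h with h1 | h2 | h3
    · exact absurd h1 hxy
    · exact Or.inl h2
    · exact Or.inr h3
  · rintro (h | ⟨z, hxz, hzy⟩)
    · exact ⟨x, rfl, Relation.ReflTransGen.single h⟩
    · exact ⟨x, rfl, (Relation.ReflTransGen.single hxz).tail hzy⟩

/-- An existential over three edges. -/
theorem exists_fin3 (P : Fin 3 → Prop) : (∃ e, P e) ↔ P 0 ∨ P 1 ∨ P 2 := by
  constructor
  · rintro ⟨e, h⟩
    fin_cases e
    · exact Or.inl h
    · exact Or.inr (Or.inl h)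
    · exact Or.inr (Or.inr h)
  · rintro (h | h | h)
    · exact ⟨0, h⟩
    · exact ⟨1, h⟩
    · exact ⟨2, h⟩

/-! ## The triangle host -/

/-- THE TRIANGLE HOST: vertices `0` (anchor), `1`, `2`; edges `0 : 0–1`, `1 : 1–2`, `2 : 2–0`; no marks. -/
def tri : ZoneData (Fin 3) (Fin 3) Empty Empty where
  fst := ![0, 1, 2]
  snd := ![1, 2, 0]
  at₁ := Empty.elim
  at₂ := Empty.elim

/-- The incidence table of the triangle. -/
theorem tri_joins_iff (e x y : Fin 3) :
    tri.Joins e x y ↔ (e = 0 ∧ ((x = 0 ∧ y = 1) ∨ (x = 1 ∧ y = 0))) ∨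
      (e = 1 ∧ ((x = 1 ∧ y = 2) ∨ (x = 2 ∧ y = 1))) ∨ (e = 2 ∧ ((x = 2 ∧ y = 0) ∨ (x = 0 ∧ y = 2))) := by
  unfold ZoneData.Joins tri
  revert e x y
  decide

variable (c : Bool) (ω : Fin 3 → Bool)

/-- The adjacencies of a colouring of the triangle, by its three edges. -/
theorem cAdj_tri_iff (x y : Fin 3) :
    cAdj tri c ω x y ↔ (((x = 0 ∧ y = 1) ∨ (x = 1 ∧ y = 0)) ∧ ω 0 = c) ∨
      (((x = 1 ∧ y = 2) ∨ (x = 2 ∧ y = 1)) ∧ ω 1 = c) ∨ (((x = 2 ∧ y = 0) ∨ (x = 0 ∧ y = 2)) ∧ ω 2 = c) := by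
  unfold cAdj
  rw [exists_fin3]
  simp only [tri_joins_iff, true_and, false_and, or_false, false_or, Fin.isValue, Fin.reduceEq, one_ne_zero,
    zero_ne_one]

/-- The statuses of a colouring, through the three-vertex reach: a generic form. -/
theorem mem_reach_tri (x y : Fin 3) (hxy : x ≠ y) :
    y ∈ reach (cAdj tri c ω) {x} ↔ cAdj tri c ω x y ∨ ∃ z, cAdj tri c ω x z ∧ cAdj tri c ω z y :=
  mem_reach_fin3 _ hxy

/-- `u = 1` is merged iff `a–u` is blue, or `u'–a` and `u–u'` are. -/
theorem Mg01_iff : tri.Mg 0 1 ω ↔ (ω 0 = false ∨ (ω 2 = false ∧ ω 1 = false)) := by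
  unfold Mg
  rw [← cAdj_false, mem_reach_tri false ω 0 1 (by decide), exists_fin3]
  simp only [cAdj_tri_iff, Fin.isValue, Fin.reduceEq, true_and, and_true, and_false, false_and, or_false,
    false_or, and_self, or_self]

/-- `u = 1` is reached iff `a–u` is red, or `u'–a` and `u–u'` are. -/
theorem Rd01_iff : tri.Rd 0 1 ω ↔ (ω 0 = true ∨ (ω 2 = true ∧ ω 1 = true)) := by
  unfold Rd
  rw [← cAdj_true, mem_reach_tri true ω 0 1 (by decide), exists_fin3]
  simp only [cAdj_tri_iff, Fin.isValue, Fin.reduceEq, true_and, and_true, and_false, false_and, or_false,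
    false_or, and_self, or_self]

/-- `u' = 2` is merged iff `u'–a` is blue, or `a–u` and `u–u'` are. -/
theorem Mg02_iff : tri.Mg 0 2 ω ↔ (ω 2 = false ∨ (ω 0 = false ∧ ω 1 = false)) := by
  unfold Mg
  rw [← cAdj_false, mem_reach_tri false ω 0 2 (by decide), exists_fin3]
  simp only [cAdj_tri_iff, Fin.isValue, Fin.reduceEq, true_and, and_true, and_false, false_and, or_false,
    false_or, and_self, or_self]

/-- `u' = 2` is reached iff `u'–a` is red, or `a–u` and `u–u'` are. -/
theorem Rd02_iff : tri.Rd 0 2 ω ↔ (ω 2 = true ∨ (ω 0 = true ∧ ω 1 = true)) := by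
  unfold Rd
  rw [← cAdj_true, mem_reach_tri true ω 0 2 (by decide), exists_fin3]
  simp only [cAdj_tri_iff, Fin.isValue, Fin.reduceEq, true_and, and_true, and_false, false_and, or_false,
    false_or, and_self, or_self]

/-- `u`, `u'` are blue-connected iff `u–u'` is blue, or `a–u` and `u'–a` are. -/
theorem Mg12_iff : tri.Mg 1 2 ω ↔ (ω 1 = false ∨ (ω 0 = false ∧ ω 2 = false)) := by
  unfold Mg
  rw [← cAdj_false, mem_reach_tri false ω 1 2 (by decide), exists_fin3]
  simp only [cAdj_tri_iff, Fin.isValue, Fin.reduceEq, true_and, and_true, and_false, false_and, or_false,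
    false_or, and_self, or_self]

/-! ## The triangle zone and the dictionary -/

variable {V E T₁ T₂ V' E' T₁' T₂' : Type} (Z : ZoneData V E T₁ T₂) (a : V) (Z' : ZoneData V' E' T₁' T₂') (a' : V')

/-- THE TRIANGLE ZONE `a – u – u' – a` with `Z` hung at `u` and `Z'` at `u'`. -/
noncomputable abbrev tri2 : ZoneData ((Fin 3 ⊕ V') ⊕ V) ((Fin 3 ⊕ E') ⊕ E) (T₁' ⊕ T₁) (T₂' ⊕ T₂) :=
  glue2 tri 1 2 Z a Z' a'

/-- The colourings of the three edges as triples. -/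
def tripleEquiv : Bool × Bool × Bool ≃ (Fin 3 → Bool) where
  toFun t := ![t.1, t.2.1, t.2.2]
  invFun ω := (ω 0, ω 1, ω 2)
  left_inv t := by
    obtain ⟨e₁, e₂, e₃⟩ := t
    rfl
  right_inv ω := by
    funext i
    fin_cases i <;> rfl

/-- **One colouring of the triangle**: the contribution of the statuses is mine-3's `triCol`. -/
theorem contrib_tri (w w' : Vec6) (e₁ e₂ e₃ : Bool) :
    contrib w w' (tri.Mg 0 1 ![e₁, e₂, e₃]) (tri.Rd 0 1 ![e₁, e₂, e₃]) (tri.Mg 0 2 ![e₁, e₂, e₃])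
      (tri.Rd 0 2 ![e₁, e₂, e₃]) (tri.Mg 1 2 ![e₁, e₂, e₃]) = triCol w w' e₁ e₂ e₃ := by
  cases e₁ <;> cases e₂ <;> cases e₃
  · -- (000): both merged, unreached
    rw [contrib, if_pos ((Mg01_iff _).2 (by decide)), if_pos ((Mg02_iff _).2 (by decide)), exitOf, exitOf,
      if_neg (fun h => absurd ((Rd01_iff _).1 h) (by decide)), if_neg (fun h => absurd ((Rd02_iff _).1 h) (by decide))]
    rfl
  · -- (001): u merged unreached, u' merged reached
    rw [contrib, if_pos ((Mg01_iff _).2 (by decide)), if_pos ((Mg02_iff _).2 (by decide)), exitOf, exitOf,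
      if_neg (fun h => absurd ((Rd01_iff _).1 h) (by decide)), if_pos ((Rd02_iff _).2 (by decide))]
    rfl
  · -- (010): both merged, unreached
    rw [contrib, if_pos ((Mg01_iff _).2 (by decide)), if_pos ((Mg02_iff _).2 (by decide)), exitOf, exitOf,
      if_neg (fun h => absurd ((Rd01_iff _).1 h) (by decide)), if_neg (fun h => absurd ((Rd02_iff _).1 h) (by decide))]
    rfl
  · -- (011): u merged reached, u' separated reached
    rw [contrib, if_pos ((Mg01_iff _).2 (by decide)), if_neg (fun h => absurd ((Mg02_iff _).1 h) (by decide)),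
      exitOf, exitOf, if_pos ((Rd01_iff _).2 (by decide)), if_pos ((Rd02_iff _).2 (by decide))]
    rfl
  · -- (100): u merged reached, u' merged unreached
    rw [contrib, if_pos ((Mg01_iff _).2 (by decide)), if_pos ((Mg02_iff _).2 (by decide)), exitOf, exitOf,
      if_pos ((Rd01_iff _).2 (by decide)), if_neg (fun h => absurd ((Rd02_iff _).1 h) (by decide))]
    rfl
  · -- (101): both separated in one sub-zone, both reached
    rw [contrib, if_neg (fun h => absurd ((Mg01_iff _).1 h) (by decide)),
      if_neg (fun h => absurd ((Mg02_iff _).1 h) (by decide)), if_pos ((Mg12_iff _).2 (by decide)), exitOf, exitOf,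
      if_pos ((Rd01_iff _).2 (by decide)), if_pos ((Rd02_iff _).2 (by decide))]
    rfl
  · -- (110): u separated reached, u' merged reached
    rw [contrib, if_neg (fun h => absurd ((Mg01_iff _).1 h) (by decide)), if_pos ((Mg02_iff _).2 (by decide)),
      exitOf, exitOf, if_pos ((Rd01_iff _).2 (by decide)), if_pos ((Rd02_iff _).2 (by decide))]
    rfl
  · -- (111): both separated apart, both reached
    rw [contrib, if_neg (fun h => absurd ((Mg01_iff _).1 h) (by decide)),
      if_neg (fun h => absurd ((Mg02_iff _).1 h) (by decide)), if_neg (fun h => absurd ((Mg12_iff _).1 h) (by decide)),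
      exitOf, exitOf, if_pos ((Rd01_iff _).2 (by decide)), if_pos ((Rd02_iff _).2 (by decide))]
    rfl

section Six

variable [Fintype E] [DecidableEq E] [Fintype T₁] [DecidableEq T₁] [Fintype T₂] [DecidableEq T₂] [Fintype E']
  [DecidableEq E'] [Fintype T₁'] [DecidableEq T₁'] [Fintype T₂'] [DecidableEq T₂']

/-- **THE TRIANGLE DICTIONARY**: the six-vector of the triangle zone `a – u – u' – a` with `Z` hung at `u` and
`Z'` at `u'`, at the anchor `a`, is mine-3's triangle map of the two six-vectors. -/
theorem sixVec_tri2 : (tri2 Z a Z' a').sixVec (Sum.inl (Sum.inl 0)) = thetaTri (Z.sixVec a) (Z'.sixVec a') := by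
  rw [sixVec_glue2, thetaTri]
  have e : ∑ t : Bool × Bool × Bool, triCol (Z.sixVec a) (Z'.sixVec a') t.1 t.2.1 t.2.2 =
      ∑ e₁ : Bool, ∑ e₂ : Bool, ∑ e₃ : Bool, triCol (Z.sixVec a) (Z'.sixVec a') e₁ e₂ e₃ := by
    rw [Fintype.sum_prod_type]
    simp only [Fintype.sum_prod_type]
  rw [← e]
  symm
  refine Fintype.sum_equiv tripleEquiv _ _ fun t => ?_
  obtain ⟨e₁, e₂, e₃⟩ := t
  exact (contrib_tri (Z.sixVec a) (Z'.sixVec a') e₁ e₂ e₃).symm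

end Six

end TwoExit

end ZoneZ

end PercRepro
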